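import Summits.QuantumFields.YangMills.Theorems.FluctuationComparisonRegPrIntLOrganTangentMarginalHClause
import Summits.QuantumFields.YangMills.Theorems.FluctuationComparisonRegPrIntLOrganTangentPullbackSquareOrgan
import Summits.QuantumFields.YangMills.Theorems.FluctuationComparisonRegPrIntLOrganTangentPullbackRowMass
import HarnessLib

/-!
# Crux `FluctuationComparisonRegPrIntL` (stmt-QuantumFields-20520, rung R3), PATH-B organ, v18 (H-currency): (MH)-PULLBACK CHECK —
# THE WILSON-TYPE MARGINAL PULLED BACK ALONG A DISPLACEMENT TRANSPORT: EXPLICIT COARSE LETTERS `√3·Xᵀ k_W X + g_Wᵀ Y` AND THEIR ROW MASS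
# `≤ √3·Ncol·Nrow·(3·β·θf²·a·16·e^{2κ}) + (4·√3·β·θf·a)·NY` — the TN-PB-SIGN test bench BY KERNEL (LEAD WORD №15's pen; DEFINITION-FREE)

Cell `ym3-torus` (YM ladder rung R3 = continuum `SU(2)` Yang–Mills on the three-torus — a RUNG: NOT d = 4, NOT infinite volume, NOT a mass gap, NOT Clay).
Width seat `ym3-torus-px8` (gen 20), pen named by LEAD `ym-ust-20520-w3` g25 WORD №15 («(MH)-PULLBACK CHECK», the kernel composition px21 g20 named 03:20Z);
`--kind proof --supports stmt-QuantumFields-20520 --as helper`, count-neutral, default heartbeats, `autoImplicit false`; registry and `Lines/` untouched.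
Credit: (MH) = this seat (✓p807894∕✓p808069); 2a = LEAD w3 g25 (✓p805782); 2a-W∕2a-O∕RM-PB = px19 g19; T2′ = px20 g17 (✓p807097).

WHAT THIS IS.  LEAD №13∕V18-LIN-KNIT-SPEC §5 «TN-PB-SIGN»: the bilinear pull-back bound `Σ |k|·|X|·|X|` is SIGN-BLIND — a transport that spreads a coarse link move
over many fine links loses the curl cancellation and overestimates the MARGINAL piece.  For the EXPLICIT marginal `R_W U := β·Σ_p c_p·(1 − reTr U(∂p))` both sides are
computable, so this file pulls it back BY NAME and makes the bookkeeping explicit: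
* §1 FIRST ORDER of the marginal: `abs_firstDiff_reTr_plaqHol_le` (`|reTr V(∂p) − reTr U(∂p)| ≤ 𝟙[b ∈ ∂p]·dist1 E` for a one-bond move, from ✓(MH) PART 1's
  letter profiles), ★`gradRow_marginal` — the WINDOWED UNIFORM-GRADIENT ROW of 2a-O's shape for `R_W` with letters `g_W b := √3·β·θ·Σ_p |c_p|·𝟙[b ∈ ∂p]`,
  `gradRow_marginal_le` (`g_W ≤ 4·√3·β·θ·a` in `d = 3`, lit ✓`letterCount_eq`);
* §2 ★★`secondDiff_pullback_marginal` — ✓2a-O `secondDiff_pullback_window` at `(R, k, g) := (R_W, k_W, g_W)` with ✓(MH) `hClauseSq_marginal` as the fine clause: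
  over a coarse `update`-square `(V; B, m; B′, m′)` and a transport `T` realised by displacement paths `E` (column letters `Xl`) and corrections `Corr` (letters `Yl`),
  `|R_W(T V₁₁) − R_W(T V₁₀) − R_W(T V₀₁) + R_W(T V₀₀)| ≤ (√3·Σ_{a c} Xl a B·k_W a c·Xl c B′ + Σ_d g_W d·Yl d B B′)·(‖m‖∕θc)·(‖m′‖∕θc)` — ALL LETTERS EXPLICIT in `(β, θf, c)`;
* §3 ★★`rowMass_pullback_marginal` — ✓RM-PB `rowMass_pullback_letters_exp` at those letters with ✓(MH) `rowMass_marginal_le_of_d_eq_three`: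
  `Σ_{B′} k_c B B′·e^{κ·|B₋ − B′₋|} ≤ √3·(Ncol·(3·β·θf²·a·16·e^{2κ})·Nrow) + (√3·β·θf·a·4)·NY` from column∕row masses `Ncol, Nrow` of `Xl·e^{κ·dX}` and the `Y`-mass `NY`.
THE CHECK (numbers, all by kernel above): the GENUINE coarse marginal `β_c·Σ_P c_P·(1 − reTr V(∂P))` has row mass `3·β_c·θc²·a·16·e^{2κ}` (✓(MH) at the coarse level);
the PULLED-BACK fine marginal carries instead `√3·Ncol·Nrow·(3·β_f·θf²·a·16·e^{2κ}) + 4√3·β_f·θf·a·NY` — in marginal units `x = w∕(β·θ²)` (with `β_f·θf² ≍ β_c·θc²` along the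
window profile) the pull-back COSTS THE FACTOR `√3·Ncol·Nrow` (+ the gradient term `4√3·a·NY∕θf` in `θf`-units, which is NOT small: a first-order letter times a second-order
displacement mass).  For a transport spreading one coarse move uniformly over the `≍ L^{3m}` fine links of a block column, `Ncol ≍ L^{3m}·(θc∕θf)` while `Nrow ≍ (θc∕θf)`, so the
marginal's coarse letters are overestimated by `≍ L^{3m}` — this is why BRICK 1 keeps the marginal SLOT `c′` (ideator №10 (2)) and extracts it BEFORE the pull-back, and why `X`
must be the LOCALISED (axial∕Landau-gauge) link response with `Ncol·Nrow = O(1)` m-uniformly ([Balaban1985Variational] Thm 1 p.279, [Balaban1984PropagatorsI] Prop 1.2 p.35 —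
LOCATE only; FL-20′'s measured `N_∞ ≈ 210`).

HONEST FRAMING: a composition of landed bookkeeping lemmas over HYPOTHESIS transport data (`T, E, Corr, Xl, Yl, dX` NOT constructed); nothing of Bałaban's analysis is asserted
or proved; SPREAD-TRANSPORT-H ∕ FIBRE-LAW-H ∕ LINᵘ-H ∕ JENᵘ-H ∕ O1ᵘ-H v2 ∕ S1aᴴ ∕ S2β, the five registered stubs OPEN; crux 20520 `FluctuationComparisonRegPrIntL` ∕ `YM3TorusSU2`
NOT proved; no summit ∕ sub-problem statement is proved by a helper; rung R3 = SU(2) YM₃ on T³ at fixed lattice data — NOT d = 4, NOT infinite volume, NOT a mass gap, NOT Clay;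
the Yang–Mills mass gap is NOT proved.  [folklore] bookkeeping.
-/

set_option autoImplicit false

noncomputable section

namespace Summit.QuantumFields.YangMills.Theorems.OrganTangentMarginalPullback

open scoped BigOperators Matrix.Norms.L2Operator
open Function
open Literature.MathematicalPhysics.QuantumFieldTheory.Balaban1983to89
open T4CubeChartGnomonic (SU2)
open T4CubeChartExp (expPt)
open T4WilsonLinkAffine (bond₁ bond₂ bond₃ bond₄ IsLetter letters_pairwise_ne letterCount letterCount_eq)
open B15Prop1JointHolomorphyFromBackground (reTr_eq_trace_re)
open Summit.QuantumFields.YangMills.Theorems.UnitScaleGibbsLinProxySU2Letters (abs_re_trace_le_two_mul_norm)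
open Summit.QuantumFields.YangMills.Theorems.OrganTangentJunctionDirectTransportCore (dist1_expPt_le_sqrt3_mul_norm)
open Summit.QuantumFields.YangMills.Theorems.OrganTangentMarginalHClauseLetters
  (norm_coe_le_one profile_mul letterProfile coe_move_le coe_move_mid_le coe_move_two_le inv_move_le inv_move_mid_le inv_move_two_le coe_plaqHol_eq)
open Summit.QuantumFields.YangMills.Theorems.OrganTangentMarginalHClause (kW_nonneg hClauseSq_marginal rowMass_marginal_le_of_d_eq_three)
open Summit.QuantumFields.YangMills.Theorems.OrganTangentPullbackSquareOrgan (secondDiff_pullback_window secondDiff_pullback_window_le)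
open Summit.QuantumFields.YangMills.Theorems.OrganTangentPullbackRowMass (rowMass_pullback_letters_exp)

/-! ## §1 First order: the windowed uniform-gradient row of the marginal -/

section FirstOrder

variable {P : Params} {j : ℕ}

/-- `|reTr V − reTr U| ≤ ‖↑V − ↑U‖_{op}` on `SU(2)`. [folklore] -/
theorem abs_sub_reTr_le_norm (U V : SU2) :
    |reTr V - reTr U| ≤ ‖(V : Matrix (Fin 2) (Fin 2) ℂ) - (U : Matrix (Fin 2) (Fin 2) ℂ)‖ := by
  simp only [reTr_eq_trace_re]
  have h := abs_re_trace_le_two_mul_norm ((V : Matrix (Fin 2) (Fin 2) ℂ) - (U : Matrix (Fin 2) (Fin 2) ℂ))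
  simp only [Matrix.trace_sub, Complex.sub_re] at h
  rw [show ((V : Matrix (Fin 2) (Fin 2) ℂ).trace.re / 2 - (U : Matrix (Fin 2) (Fin 2) ℂ).trace.re / 2) =
      ((V : Matrix (Fin 2) (Fin 2) ℂ).trace.re - (U : Matrix (Fin 2) (Fin 2) ℂ).trace.re) / 2 by ring, abs_div,
    abs_of_pos (by norm_num : (0:ℝ) < 2)]
  linarith

/-- First-order support bookkeeping: at most one of four pairwise distinct positions carries the bond `b`. [folklore] -/
theorem support_bookkeeping₁ {ι : Type*} [DecidableEq ι] {e₀ e₁ e₂ e₃ b : ι} {d : ℝ}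
    (h01 : e₀ ≠ e₁) (h02 : e₀ ≠ e₂) (h03 : e₀ ≠ e₃) (h12 : e₁ ≠ e₂) (h13 : e₁ ≠ e₃) (h23 : e₂ ≠ e₃) :
    (if e₀ = b then d else 0) + (if e₁ = b then d else 0) + (if e₂ = b then d else 0) + (if e₃ = b then d else 0) ≤
      (if (b = e₀ ∨ b = e₁ ∨ b = e₂ ∨ b = e₃) then (1:ℝ) else 0) * d := by
  by_cases hb : b = e₀ ∨ b = e₁ ∨ b = e₂ ∨ b = e₃
  · simp only [hb, if_true, one_mul]
    rcases hb with rfl | rfl | rfl | rfl <;>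
      simp [h01, h02, h03, h12, h13, h23, h01.symm, h02.symm, h03.symm, h12.symm, h13.symm, h23.symm]
  · simp only [hb, if_false, zero_mul]
    simp only [not_or] at hb
    obtain ⟨h0, h1, h2, h3⟩ := hb
    simp [Ne.symm h0, Ne.symm h1, Ne.symm h2, Ne.symm h3]

/-- ★ **FIRST ORDER OF ONE PLAQUETTE TERM UNDER A ONE-BOND MOVE**: `|reTr V(∂p) − reTr U(∂p)| ≤ 𝟙[b ∈ ∂p]·dist1 E` for `V = U` off `b`, `V b = U b·E`
(from ✓(MH) PART 1's letter profiles with a trivial second move). [folklore] -/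
theorem abs_firstDiff_reTr_plaqHol_le [DecidableEq (PBond P j)] (p : Plaq P j)
    {U V : GaugeField P j SU2} {b : PBond P j} {E : SU2}
    (hV : ∀ e, e ≠ b → V e = U e) (hVb : V b = U b * E) :
    |reTr (GaugeField.plaqHol V p) - reTr (GaugeField.plaqHol U p)| ≤ (if IsLetter b p then (1:ℝ) else 0) * dist1 E := by
  -- the three-move profile with the second move trivial (`b′ := b`, `E′ := 1`, `W := U`, `Z := V`)
  have hW : ∀ e, e ≠ b → U e = U e := fun _ _ => rfl
  have hWb : U b = U b * (1 : SU2) := (mul_one _).symm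
  have hZ : ∀ e, e ≠ b → V e = V e := fun _ _ => rfl
  have hZb : V b = V b * (1 : SU2) := (mul_one _).symm
  have h₁ := letterProfile (φ := fun g : SU2 => (g : Matrix (Fin 2) (Fin 2) ℂ)) norm_coe_le_one coe_move_le coe_move_mid_le
    coe_move_two_le (bond₁ p) hV hVb hW hWb hZ hZb
  have h₂ := letterProfile (φ := fun g : SU2 => (g : Matrix (Fin 2) (Fin 2) ℂ)) norm_coe_le_one coe_move_le coe_move_mid_le
    coe_move_two_le (bond₂ p) hV hVb hW hWb hZ hZb
  have h₃ := letterProfile (φ := fun g : SU2 => ((g⁻¹ : SU2) : Matrix (Fin 2) (Fin 2) ℂ)) (fun g => norm_coe_le_one _)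
    inv_move_le inv_move_mid_le inv_move_two_le (bond₃ p) hV hVb hW hWb hZ hZb
  have h₄ := letterProfile (φ := fun g : SU2 => ((g⁻¹ : SU2) : Matrix (Fin 2) (Fin 2) ℂ)) (fun g => norm_coe_le_one _)
    inv_move_le inv_move_mid_le inv_move_two_le (bond₄ p) hV hVb hW hWb hZ hZb
  have h01 := profile_mul h₁ h₂
  have h012 := profile_mul h01 h₃
  have h0123 := profile_mul h012 h₄
  have key := h0123.2.2.2.2.1
  refine (abs_sub_reTr_le_norm _ _).trans ?_
  rw [coe_plaqHol_eq, coe_plaqHol_eq]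
  refine key.trans ?_
  obtain ⟨n12, n13, n14, n23, n24, n34⟩ := letters_pairwise_ne p
  have hb := support_bookkeeping₁ (b := b) (d := dist1 E) n12 n13 n14 n23 n24 n34
  linarith [hb]

/-- ★ **THE WINDOWED UNIFORM-GRADIENT ROW OF THE MARGINAL** (✓2a-O `secondDiff_pullback_window`'s `hG` shape): for `R_W U := β·Σ_p c_p·(1 − reTr U(∂p))`,
`0 ≤ β`, `0 < θ`, any cap `r`: `|R_W (U[b ↦ U_b·e^{u}]) − R_W U| ≤ g_W b·(‖u‖∕θ)` with `g_W b := √3·β·θ·Σ_p |c_p|·(if IsLetter b p then 1 else 0)`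
(window and cap unused). [folklore] -/
theorem gradRow_marginal [DecidableEq (PBond P j)] (c : Plaq P j → ℝ) {β θ : ℝ} (hβ : 0 ≤ β) (hθ : 0 < θ) (r : ℝ) :
    ∀ (U : GaugeField P j ↥(Matrix.specialUnitaryGroup (Fin 2) ℂ)) (b : PBond P j) (u : Fin 3 → ℝ),
      PlaqSmall θ U → ‖u‖ / θ ≤ r →
      |(β * ∑ p, c p * (1 - reTr (GaugeField.plaqHol (update U b (U b * expPt u)) p))) -
          (β * ∑ p, c p * (1 - reTr (GaugeField.plaqHol U p)))| ≤
        (Real.sqrt 3 * β * θ * ∑ p, |c p| * (if IsLetter b p then (1:ℝ) else 0)) * (‖u‖ / θ) := by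
  intro U b u _ _
  have hθ0 : θ ≠ 0 := hθ.ne'
  have hV : ∀ e, e ≠ b → update U b (U b * expPt u) e = U e := fun e he => update_of_ne he _ _
  have hVb : update U b (U b * expPt u) b = U b * expPt u := update_self _ _ _
  have hd : dist1 (expPt u) ≤ Real.sqrt 3 * ‖u‖ := dist1_expPt_le_sqrt3_mul_norm u
  rw [Finset.mul_sum, Finset.mul_sum, ← Finset.sum_sub_distrib]
  have hR : (Real.sqrt 3 * β * θ * ∑ p, |c p| * (if IsLetter b p then (1:ℝ) else 0)) * (‖u‖ / θ) =
      ∑ p, β * |c p| * ((if IsLetter b p then (1:ℝ) else 0) * (Real.sqrt 3 * ‖u‖)) := by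
    rw [Finset.mul_sum, Finset.sum_mul]
    refine Finset.sum_congr rfl fun p _ => ?_
    field_simp
  rw [hR]
  refine (Finset.abs_sum_le_sum_abs _ _).trans (Finset.sum_le_sum fun p _ => ?_)
  have e : β * (c p * (1 - reTr (GaugeField.plaqHol (update U b (U b * expPt u)) p))) - β * (c p * (1 - reTr (GaugeField.plaqHol U p))) =
      -(β * (c p * (reTr (GaugeField.plaqHol (update U b (U b * expPt u)) p) - reTr (GaugeField.plaqHol U p)))) := by ring
  rw [e, abs_neg, abs_mul, abs_mul, abs_of_nonneg hβ]
  have hp := abs_firstDiff_reTr_plaqHol_le p hV hVb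
  have hι : 0 ≤ (if IsLetter b p then (1:ℝ) else 0) := by split_ifs <;> norm_num
  calc β * (|c p| * |reTr (GaugeField.plaqHol (update U b (U b * expPt u)) p) - reTr (GaugeField.plaqHol U p)|)
      ≤ β * (|c p| * ((if IsLetter b p then (1:ℝ) else 0) * dist1 (expPt u))) :=
        mul_le_mul_of_nonneg_left (mul_le_mul_of_nonneg_left hp (abs_nonneg _)) hβ
    _ ≤ β * (|c p| * ((if IsLetter b p then (1:ℝ) else 0) * (Real.sqrt 3 * ‖u‖))) := by gcongr
    _ = β * |c p| * ((if IsLetter b p then (1:ℝ) else 0) * (Real.sqrt 3 * ‖u‖)) := by ring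

/-- The gradient letters are nonnegative. [folklore] -/
theorem gW_nonneg [DecidableEq (PBond P j)] (c : Plaq P j → ℝ) {β : ℝ} (hβ : 0 ≤ β) {θ : ℝ} (hθ : 0 ≤ θ) (b : PBond P j) :
    0 ≤ Real.sqrt 3 * β * θ * ∑ p, |c p| * (if IsLetter b p then (1:ℝ) else 0) :=
  mul_nonneg (mul_nonneg (mul_nonneg (Real.sqrt_nonneg 3) hβ) hθ)
    (Finset.sum_nonneg fun p _ => mul_nonneg (abs_nonneg _) (by split_ifs <;> norm_num))

/-- The gradient letters are UNIFORMLY bounded: `g_W b ≤ √3·β·θ·a·(2(d−1))` when `|c_p| ≤ a` (a bond is a letter of `2(d−1)` plaquettes, lit ✓`letterCount_eq`). [folklore] -/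
theorem gradRow_marginal_le [DecidableEq (PBond P j)] (c : Plaq P j → ℝ) {a β θ : ℝ} (ha : ∀ p, |c p| ≤ a) (hβ : 0 ≤ β) (hθ : 0 ≤ θ)
    (b : PBond P j) :
    Real.sqrt 3 * β * θ * ∑ p, |c p| * (if IsLetter b p then (1:ℝ) else 0) ≤ Real.sqrt 3 * β * θ * a * (2 * (P.d - 1 : ℕ)) := by
  have hC : 0 ≤ Real.sqrt 3 * β * θ := mul_nonneg (mul_nonneg (Real.sqrt_nonneg 3) hβ) hθ
  have e1 : ∑ p, |c p| * (if IsLetter b p then (1:ℝ) else 0) ≤ ∑ p : Plaq P j, a * (if IsLetter b p then (1:ℝ) else 0) :=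
    Finset.sum_le_sum fun p _ => mul_le_mul_of_nonneg_right (ha p) (by split_ifs <;> norm_num)
  have e2 : ∑ p : Plaq P j, a * (if IsLetter b p then (1:ℝ) else 0) = a * (letterCount b : ℝ) := by
    rw [← Finset.mul_sum, letterCount, Finset.sum_boole]
  rw [e2, letterCount_eq] at e1
  calc Real.sqrt 3 * β * θ * ∑ p, |c p| * (if IsLetter b p then (1:ℝ) else 0)
      ≤ Real.sqrt 3 * β * θ * (a * ((2 * (P.d - 1) : ℕ) : ℝ)) := mul_le_mul_of_nonneg_left e1 hC
    _ = Real.sqrt 3 * β * θ * a * (2 * (P.d - 1 : ℕ)) := by push_cast; ring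

/-- `d = 3`: `g_W b ≤ √3·β·θ·a·4`. [folklore] -/
theorem gradRow_marginal_le_of_d_eq_three [DecidableEq (PBond P j)] (hd : P.d = 3) (c : Plaq P j → ℝ) {a β θ : ℝ} (ha : ∀ p, |c p| ≤ a)
    (hβ : 0 ≤ β) (hθ : 0 ≤ θ) (b : PBond P j) :
    Real.sqrt 3 * β * θ * ∑ p, |c p| * (if IsLetter b p then (1:ℝ) else 0) ≤ Real.sqrt 3 * β * θ * a * 4 := by
  have h := gradRow_marginal_le c ha hβ hθ b
  have h2 : ((P.d - 1 : ℕ) : ℝ) = 2 := by rw [hd]; norm_num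
  rw [h2] at h
  linarith

end FirstOrder

/-! ## §2 Second order: the marginal pulled back along a displacement transport (✓2a-O ∘ ✓MH) -/

section Pullback

variable {Pf Pc : Params} {jf jc : ℕ} [DecidableEq (PBond Pf jf)] [DecidableEq (PBond Pc jc)]

/-- ★★ **(MH)-PULLBACK**: the Wilson-type marginal `R_W U := β·Σ_p c_p·(1 − reTr U(∂p))` on the fine `θf`-window (its own pair clause ✓`hClauseSq_marginal` with
letters `k_W`, its own gradient row `gradRow_marginal` with letters `g_W`) pulled back along a transport `T` realised by displacement paths `E` (column letters `Xl`)
and corrections `Corr` (letters `Yl`) — ✓2a-O `secondDiff_pullback_window` with EVERY LETTER EXPLICIT: over the coarse `update`-square,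
`|R_W(T V₁₁) − R_W(T V₁₀) − R_W(T V₀₁) + R_W(T V₀₀)| ≤ (√3·Σ_{a c} Xl a B·k_W a c·Xl c B′ + Σ_d g_W d·Yl d B B′)·(‖m‖∕θc)·(‖m′‖∕θc)`. [folklore] -/
theorem secondDiff_pullback_marginal {θf θc rf β : ℝ} (hθf : 0 < θf) (hβ : 0 ≤ β) (c : Plaq Pf jf → ℝ)
    (T : GaugeField Pc jc (Matrix.specialUnitaryGroup (Fin 2) ℂ) → GaugeField Pf jf (Matrix.specialUnitaryGroup (Fin 2) ℂ))
    (E : GaugeField Pc jc (Matrix.specialUnitaryGroup (Fin 2) ℂ) → PBond Pc jc → (Fin 3 → ℝ) → List (PBond Pf jf × (Fin 3 → ℝ)))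
    (Corr : GaugeField Pc jc (Matrix.specialUnitaryGroup (Fin 2) ℂ) → PBond Pc jc → (Fin 3 → ℝ) → PBond Pc jc → (Fin 3 → ℝ) →
      List (PBond Pf jf × (Fin 3 → ℝ)))
    (Xl : PBond Pf jf → PBond Pc jc → ℝ) (Yl : PBond Pf jf → PBond Pc jc → PBond Pc jc → ℝ)
    (hE : ∀ (V : GaugeField Pc jc (Matrix.specialUnitaryGroup (Fin 2) ℂ)) (B : PBond Pc jc) (m : Fin 3 → ℝ),
      (E V B m).foldl (fun U p => update U p.1 (U p.1 * expPt p.2)) (T V) = T (update V B (V B * expPt m)))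
    (hCorr : ∀ (V : GaugeField Pc jc (Matrix.specialUnitaryGroup (Fin 2) ℂ)) (B : PBond Pc jc) (m : Fin 3 → ℝ) (B' : PBond Pc jc) (m' : Fin 3 → ℝ),
      (Corr V B m B' m').foldl (fun U p => update U p.1 (U p.1 * expPt p.2))
          ((E V B' m').foldl (fun U p => update U p.1 (U p.1 * expPt p.2)) ((E V B m).foldl (fun U p => update U p.1 (U p.1 * expPt p.2)) (T V))) =
        T (update (update V B (V B * expPt m)) B' ((update V B (V B * expPt m)) B' * expPt m')))
    (hX : ∀ (V : GaugeField Pc jc (Matrix.specialUnitaryGroup (Fin 2) ℂ)) (B : PBond Pc jc) (m : Fin 3 → ℝ) (a₀ : PBond Pf jf),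
      (((E V B m).filter (fun p => decide (p.1 = a₀))).map (fun p => ‖p.2‖ / θf)).sum ≤ Xl a₀ B * (‖m‖ / θc))
    (hY : ∀ (V : GaugeField Pc jc (Matrix.specialUnitaryGroup (Fin 2) ℂ)) (B : PBond Pc jc) (m : Fin 3 → ℝ) (B' : PBond Pc jc) (m' : Fin 3 → ℝ)
      (d₀ : PBond Pf jf),
      (((Corr V B m B' m').filter (fun p => decide (p.1 = d₀))).map (fun p => ‖p.2‖ / θf)).sum ≤ Yl d₀ B B' * (‖m‖ / θc) * (‖m'‖ / θc))
    (V : GaugeField Pc jc (Matrix.specialUnitaryGroup (Fin 2) ℂ)) (B B' : PBond Pc jc) (m m' : Fin 3 → ℝ)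
    (hszP : ∀ a ∈ E V B m, Real.sqrt 3 * (‖a.2‖ / θf) ≤ rf) (hszQ : ∀ c' ∈ E V B' m', ‖c'.2‖ / θf ≤ rf)
    (hszC : ∀ d ∈ Corr V B m B' m', ‖d.2‖ / θf ≤ rf)
    (hgrid : ∀ i l, i ≤ (E V B m).length → l ≤ (E V B' m').length →
      PlaqSmall θf (((E V B' m').take l).foldl (fun U p => update U p.1 (U p.1 * expPt p.2))
        (((E V B m).take i).foldl (fun U p => update U p.1 (U p.1 * expPt p.2)) (T V))))
    (hcorr : ∀ i, i < (Corr V B m B' m').length →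
      PlaqSmall θf (((Corr V B m B' m').take i).foldl (fun U p => update U p.1 (U p.1 * expPt p.2))
        ((E V B' m').foldl (fun U p => update U p.1 (U p.1 * expPt p.2)) ((E V B m).foldl (fun U p => update U p.1 (U p.1 * expPt p.2)) (T V))))) :
    |(β * ∑ p, c p * (1 - reTr (GaugeField.plaqHol (T (update (update V B (V B * expPt m)) B' ((update V B (V B * expPt m)) B' * expPt m'))) p)))
        - (β * ∑ p, c p * (1 - reTr (GaugeField.plaqHol (T (update V B (V B * expPt m))) p)))
        - (β * ∑ p, c p * (1 - reTr (GaugeField.plaqHol (T (update V B' (V B' * expPt m'))) p)))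
        + (β * ∑ p, c p * (1 - reTr (GaugeField.plaqHol (T V) p)))|
      ≤ (Real.sqrt 3 * ∑ a₀ : PBond Pf jf, ∑ c₀ : PBond Pf jf,
            Xl a₀ B * (3 * β * θf ^ 2 * ∑ p, |c p| * (if IsLetter a₀ p ∧ IsLetter c₀ p then (1:ℝ) else 0)) * Xl c₀ B'
          + ∑ d₀ : PBond Pf jf, (Real.sqrt 3 * β * θf * ∑ p, |c p| * (if IsLetter d₀ p then (1:ℝ) else 0)) * Yl d₀ B B')
        * (‖m‖ / θc) * (‖m'‖ / θc) :=
  secondDiff_pullback_window hθf (k := fun b b' => 3 * β * θf ^ 2 * ∑ p, |c p| * (if IsLetter b p ∧ IsLetter b' p then (1:ℝ) else 0))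
    (fun b b' => kW_nonneg c hβ θf b b') (R := fun U => β * ∑ p, c p * (1 - reTr (GaugeField.plaqHol U p)))
    (hClauseSq_marginal c hβ hθf rf)
    (fun b => Real.sqrt 3 * β * θf * ∑ p, |c p| * (if IsLetter b p then (1:ℝ) else 0)) (fun d => gW_nonneg c hβ hθf.le d)
    (gradRow_marginal c hβ hθf rf) T E Corr Xl Yl hE hCorr hX hY V B B' m m' hszP hszQ hszC hgrid hcorr

end Pullback

/-! ## §3 The row mass of the pulled-back marginal's coarse letters (✓RM-PB ∘ ✓MH) -/

section RowMass

variable {Pf Pc : Params} {jf jc : ℕ} [DecidableEq (PBond Pf jf)]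

/-- ★★ **ROW MASS OF THE PULLED-BACK MARGINAL** (`d = 3` on the fine torus): with column∕row masses `Ncol, Nrow` of `Xl·e^{κ·dX}`, the `Y`-mass `NY`, a displacement distance
`dX` dominating the coarse geometry (`|B₋ − B′₋| ≤ dX a B + |a₋ − c₋| + dX c B′`) and `|c_p| ≤ a`, the coarse letters `k_c := √3·Xᵀ k_W X + g_Wᵀ Y` of §2 satisfy
`Σ_{B′} k_c B B′·e^{κ·|B₋ − B′₋|} ≤ √3·(Ncol·(3·β·θf²·a·16·e^{2κ})·Nrow) + (√3·β·θf·a·4)·NY` (✓RM-PB `rowMass_pullback_letters_exp` with ✓(MH) `rowMass_marginal_le_of_d_eq_three`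
and §1 `gradRow_marginal_le_of_d_eq_three`). COMPARE: the genuine coarse marginal's own letters have row mass `3·β_c·θc²·a·16·e^{2κ}` (✓(MH) at the coarse level). [folklore] -/
theorem rowMass_pullback_marginal (hd : Pf.d = 3) {κ β θf a : ℝ} (hκ : 0 ≤ κ) (hβ : 0 ≤ β) (hθf : 0 ≤ θf)
    (c : Plaq Pf jf → ℝ) (ha0 : 0 ≤ a) (ha : ∀ p, |c p| ≤ a)
    (Xl : PBond Pf jf → PBond Pc jc → ℝ) (Yl : PBond Pf jf → PBond Pc jc → PBond Pc jc → ℝ) (dX : PBond Pf jf → PBond Pc jc → ℝ)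
    (hX : ∀ a' B, 0 ≤ Xl a' B) (hY : ∀ d B B', 0 ≤ Yl d B B')
    (hdX : ∀ (B B' : PBond Pc jc) (a' c' : PBond Pf jf),
      (B.src.tdist B'.src : ℝ) ≤ dX a' B + (a'.src.tdist c'.src : ℝ) + dX c' B')
    {Ncol Nrow NY : ℝ} (hNrow : 0 ≤ Nrow)
    (hcol : ∀ B, ∑ a', Xl a' B * Real.exp (κ * dX a' B) ≤ Ncol)
    (hrow : ∀ c', ∑ B', Xl c' B' * Real.exp (κ * dX c' B') ≤ Nrow)
    (hYmass : ∀ B, ∑ d, ∑ B', Yl d B B' * Real.exp (κ * (B.src.tdist B'.src : ℝ)) ≤ NY) :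
    ∀ B : PBond Pc jc,
      ∑ B', (Real.sqrt 3 * ∑ a₀ : PBond Pf jf, ∑ c₀ : PBond Pf jf,
              Xl a₀ B * (3 * β * θf ^ 2 * ∑ p, |c p| * (if IsLetter a₀ p ∧ IsLetter c₀ p then (1:ℝ) else 0)) * Xl c₀ B'
            + ∑ d₀ : PBond Pf jf, (Real.sqrt 3 * β * θf * ∑ p, |c p| * (if IsLetter d₀ p then (1:ℝ) else 0)) * Yl d₀ B B')
          * Real.exp (κ * (B.src.tdist B'.src : ℝ))
        ≤ Real.sqrt 3 * (Ncol * (3 * β * θf ^ 2 * a * 16 * Real.exp (2 * κ)) * Nrow) + (Real.sqrt 3 * β * θf * a * 4) * NY := by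
  have hw : 0 ≤ 3 * β * θf ^ 2 * a * 16 * Real.exp (2 * κ) :=
    mul_nonneg (mul_nonneg (mul_nonneg (mul_nonneg (mul_nonneg (by norm_num) hβ) (sq_nonneg θf)) ha0) (by norm_num)) (Real.exp_nonneg _)
  have hG0 : 0 ≤ Real.sqrt 3 * β * θf * a * 4 :=
    mul_nonneg (mul_nonneg (mul_nonneg (mul_nonneg (Real.sqrt_nonneg 3) hβ) hθf) ha0) (by norm_num)
  exact rowMass_pullback_letters_exp κ hκ
    (fun b b' => 3 * β * θf ^ 2 * ∑ p, |c p| * (if IsLetter b p ∧ IsLetter b' p then (1:ℝ) else 0))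
    (fun b => Real.sqrt 3 * β * θf * ∑ p, |c p| * (if IsLetter b p then (1:ℝ) else 0)) (Real.sqrt 3) Xl Yl dX
    (fun b b' => kW_nonneg c hβ θf b b') (Real.sqrt_nonneg 3) hX hY hdX hw hNrow hG0 hcol hrow
    (fun b => rowMass_marginal_le_of_d_eq_three hd c θf ha hβ hκ b) (fun d => gradRow_marginal_le_of_d_eq_three hd c ha hβ hθf d) hYmass

end RowMass

end Summit.QuantumFields.YangMills.Theorems.OrganTangentMarginalPullback

end
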